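import Summits.Ventures.PercRepro.SixFourPLList

/-!
# PercRepro — C-025 at `(6,4)`, step (4) of `PLJlow`, part A: the list bridge, the `X̄′` data side, covering pairs of a
family, the listed traces and `PLTraceData` (mine-2; pre-cut of `SixFourPLCov3.lean` l.27–261, bodies verbatim)

The step-(4) chain of record (`MINE2-RLS.md` §21.18.9.2, PRECISION 3) is `Xcnt M G ≤ Σ_{covPairs3} 2^{|P ∩ P′ ∩ G|} ≤
X̄(profile D)` (resp. `≤ X̄′(profile D)` at `g = 8, 9`), cut into gate-sized modules: `SixFourPLCovPairs3` (the first
inequality, on the rank-3-trace planes; imports the landed `SixFourT4XA`) and `SixFourPLCov3A → SixFourPLCov3B →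
SixFourPLCov3C → SixFourPLCov3D` (the second inequality as pure finite-set statements; `SixFourPLCov3A` imports the
landed `SixFourPLList`), joined by `SixFourPLSeam` (`Xcnt_le_Xbar_seam`, `Xcnt_le_Xbar'_seam`). The bodies are those of
lean-drafts/mine-2/SixFourPLCov3.lean (1,012 lines, sha16 54cf6c11e44bf06b) verbatim; only the preambles differ.

This part: (§1, `namespace PL`) the list / multiset bridge (`length_filter_cons`, `sum_map_ite`, `two_mul_countPairs_add`,
`sum_card_eq_list`, `card_filter_card_eq_list`, `card_filter_product_eq_two_mul_countPairs`) and the §21.18.9.2 data-side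
definitions `covOld`, `covCoef`, `covNew`, `Xbar'`, `list_sum_range`; (§2) `covPairsOf T G` — the ordered pairs of distinct
members of `T` whose union contains `G` — with `sum_covPairsOf_eq`, `cw_comm`, `sum_covPairsOf_mono`,
`sum_covPairsOf_image_inter`; (§3) the listed traces `piTraces`, `xlTraces`, `tracesOf` and the hypothesis bundle
`PLTraceData π ρ L C N` of a plane-line normalisation on its traces. Imports only the landed `SixFourPLList`.
-/

namespace PercRepro.SixFour

open Finset

/-! ## Lists, multisets and the class-size list -/

namespace PL

/-- The length of a filtered cons. -/
theorem length_filter_cons (p : ℕ → Bool) (a : ℕ) (l : List ℕ) :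
    (List.filter p (a :: l)).length = (if p a = true then 1 else 0) + (List.filter p l).length := by
  by_cases h : p a = true
  · simp [h, Nat.add_comm]
  · simp [h]

/-- A sum of indicator values is a filter length. -/
theorem sum_map_ite (p : ℕ → Bool) : ∀ l : List ℕ,
    (l.map fun b => if p b = true then 1 else 0).sum = (l.filter p).length
  | [] => rfl
  | a :: l => by
    rw [List.map_cons, List.sum_cons, length_filter_cons, sum_map_ite p l]

/-- `2·countPairs l f + #{a ∈ l : f a a} = Σ_{a ∈ l} #{b ∈ l : f a b}` for a symmetric `f`. -/
theorem two_mul_countPairs_add (f : ℕ → ℕ → Bool) (hf : ∀ a b, f a b = f b a) : ∀ l : List ℕ,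
    2 * countPairs l f + (l.filter fun a => f a a).length =
      (l.map fun a => (l.filter (f a)).length).sum
  | [] => rfl
  | a :: l => by
    have ih := two_mul_countPairs_add f hf l
    simp only [countPairs, List.map_cons, List.sum_cons, length_filter_cons]
    have h1 : (l.map fun b => (if f b a = true then 1 else 0) + (List.filter (f b) l).length).sum =
        (l.filter (f a)).length + (l.map fun b => (List.filter (f b) l).length).sum := by
      rw [List.sum_map_add, ← sum_map_ite (f a) l]
      congr 2
      apply List.map_congr_left
      intro b _
      rw [hf b a]
    rw [h1]
    split_ifs <;> omega

variable {α : Type*} [DecidableEq α]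

omit [DecidableEq α] in
/-- A sum over a finset of finsets of a function of the cardinality, through the list of cardinalities. -/
theorem sum_card_eq_list {C : Finset (Finset α)} {l : List ℕ} (hl : (l : Multiset ℕ) = C.val.map Finset.card)
    (g : ℕ → ℕ) : ∑ A ∈ C, g A.card = (l.map g).sum := by
  rw [Finset.sum_eq_multiset_sum, ← Multiset.sum_coe, ← Multiset.map_coe, hl, Multiset.map_map]
  rfl

omit [DecidableEq α] in
/-- A cardinality-filter count, through the list. -/
theorem card_filter_card_eq_list {C : Finset (Finset α)} {l : List ℕ}
    (hl : (l : Multiset ℕ) = C.val.map Finset.card) (P : ℕ → Prop) [DecidablePred P] :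
    (C.filter fun A => P A.card).card = (l.filter fun a => decide (P a)).length := by
  rw [Finset.card_filter, sum_card_eq_list hl (fun a => if P a then 1 else 0),
    ← sum_map_ite (fun a => decide (P a)) l]
  simp only [decide_eq_true_eq]

/-- The ordered pairs of DISTINCT members of `C` whose cardinalities satisfy a symmetric `f`, counted through
`countPairs` on the size list. -/
theorem card_filter_product_eq_two_mul_countPairs {C : Finset (Finset α)} {l : List ℕ}
    (hl : (l : Multiset ℕ) = C.val.map Finset.card) (f : ℕ → ℕ → Bool) (hf : ∀ a b, f a b = f b a) :
    ((C ×ˢ C).filter fun q => q.1 ≠ q.2 ∧ f q.1.card q.2.card = true).card = 2 * countPairs l f := by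
  have hrow : ∀ A ∈ C, (C.filter fun B => A ≠ B ∧ f A.card B.card = true).card +
      (if f A.card A.card = true then 1 else 0) = (C.filter fun B => f A.card B.card = true).card := by
    intro A hA
    rw [Finset.card_filter, Finset.card_filter]
    have hdiag : (if f A.card A.card = true then 1 else 0) =
        ∑ B ∈ C, if A = B then (if f A.card B.card = true then 1 else 0) else 0 := by
      rw [Finset.sum_ite_eq, if_pos hA]
    rw [hdiag, ← Finset.sum_add_distrib]
    apply Finset.sum_congr rfl
    intro B _
    by_cases hAB : A = B
    · subst hAB
      simp
    · simp [hAB]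
  have hsum : ((C ×ˢ C).filter fun q => q.1 ≠ q.2 ∧ f q.1.card q.2.card = true).card =
      ∑ A ∈ C, (C.filter fun B => A ≠ B ∧ f A.card B.card = true).card := by
    rw [Finset.card_filter, Finset.sum_product]
    exact Finset.sum_congr rfl (fun A _ => (Finset.card_filter _ _).symm)
  have htot : ∑ A ∈ C, (C.filter fun B => A ≠ B ∧ f A.card B.card = true).card +
      (C.filter fun A => f A.card A.card = true).card =
      ∑ A ∈ C, (C.filter fun B => f A.card B.card = true).card := by
    rw [Finset.card_filter, ← Finset.sum_add_distrib]
    exact Finset.sum_congr rfl (fun A hA => hrow A hA)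
  have hrows : ∑ A ∈ C, (C.filter fun B => f A.card B.card = true).card =
      (l.map fun a => (l.filter (f a)).length).sum := by
    rw [← sum_card_eq_list hl (fun a => (l.filter (f a)).length)]
    apply Finset.sum_congr rfl
    intro A _
    rw [card_filter_card_eq_list hl (fun b => f A.card b = true)]
    simp only [Bool.decide_eq_true]
  have hdiag : (C.filter fun A => f A.card A.card = true).card = (l.filter fun a => f a a).length := by
    rw [card_filter_card_eq_list hl (fun a => f a a = true)]
    simp only [Bool.decide_eq_true]
  have key := two_mul_countPairs_add f hf l
  rw [hsum]
  omega

/-! ### Lemma X̄′ — the data side of `MINE2-RLS.md` §21.18.9.2 (as printed there; `covOld` is the third term of `Xbar`) -/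

/-- The present covered-class count: `#{j : ν_{p−s_j} > 0 ∨ ν_{p−s_j+1} > 0}`. -/
def covOld (π : CProf) : ℕ :=
  (π.sizes.filter fun s => 0 < nu π (π.p - s) ∨ 0 < nu π (π.p - s + 1)).length

/-- `c_m`: for `3 ≤ m ≤ p − 2`, `[∃ j, s_j ∈ {p − m, p − m + 1}]`; for `m = p − 1`: skew `[∃ j, s_j ≤ 2]`, meet
`#{j : s_j = 2}`. -/
def covCoef (π : CProf) (m : ℕ) : ℕ :=
  if m + 1 = π.p then (if π.meet then π.sizes.count 2 else if π.sizes.any (fun s => s ≤ 2) then 1 else 0)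
  else if π.sizes.any (fun s => s + m = π.p ∨ s + m = π.p + 1) then 1 else 0

/-- `Σ_{3 ≤ m ≤ p−1} ν_m · c_m`. -/
def covNew (π : CProf) : ℕ := ((List.range (π.p - 3)).map fun i => nu π (i + 3) * covCoef π (i + 3)).sum

/-- `X̄′(π) = 2·[Σ_j 2^{s_j} + 2^{n+e}·#{j < k : s_j + s_k = p + e} + 4n·min(covOld, covNew)]`. -/
def Xbar' (π : CProf) : ℕ := 2 * ((π.sizes.map fun s => 2 ^ s).sum +
  2 ^ lprime π * countPairs π.sizes (fun a b => a + b = π.p + e π) + 4 * π.n * min (covOld π) (covNew π))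

/-- A list sum over `range n` is the finset sum. -/
theorem list_sum_range (f : ℕ → ℕ) : ∀ n : ℕ, ((List.range n).map f).sum = ∑ i ∈ Finset.range n, f i
  | 0 => by simp
  | n + 1 => by
    rw [List.range_succ, List.map_append, List.sum_append, Finset.sum_range_succ, list_sum_range f n]
    simp

end PL

/-! ## Covering pairs of a family of sets -/

variable {α : Type*} [DecidableEq α]

/-- The ordered pairs of DISTINCT members of `T` whose union contains `G`. -/
def covPairsOf (T : Finset (Finset α)) (G : Finset α) : Finset (Finset α × Finset α) :=
  (T ×ˢ T).filter (fun pp => pp.1 ≠ pp.2 ∧ G ⊆ pp.1 ∪ pp.2)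

/-- Membership in `covPairsOf`. -/
theorem mem_covPairsOf {T : Finset (Finset α)} {G : Finset α} {pp : Finset α × Finset α} :
    pp ∈ covPairsOf T G ↔ (pp.1 ∈ T ∧ pp.2 ∈ T) ∧ pp.1 ≠ pp.2 ∧ G ⊆ pp.1 ∪ pp.2 := by
  unfold covPairsOf
  rw [Finset.mem_filter, Finset.mem_product]

/-- The covering-pair weight `2^{|S ∩ S′|}` of an ordered pair of distinct sets covering `G` (else `0`). -/
def cw (G S S' : Finset α) : ℕ := if S ≠ S' ∧ G ⊆ S ∪ S' then 2 ^ (S ∩ S').card else 0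

/-- The covering-pair sum as a double sum of weights. -/
theorem sum_covPairsOf_eq (T : Finset (Finset α)) (G : Finset α) :
    ∑ pp ∈ covPairsOf T G, 2 ^ (pp.1 ∩ pp.2).card = ∑ S ∈ T, ∑ S' ∈ T, cw G S S' := by
  unfold covPairsOf cw
  rw [Finset.sum_filter, Finset.sum_product]

/-- The weight is symmetric. -/
theorem cw_comm (G S S' : Finset α) : cw G S S' = cw G S' S := by
  unfold cw
  by_cases h : S ≠ S' ∧ G ⊆ S ∪ S'
  · rw [if_pos h, if_pos ⟨h.1.symm, by rw [Finset.union_comm]; exact h.2⟩, Finset.inter_comm]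
  · rw [if_neg h, if_neg (fun h' => h ⟨h'.1.symm, by rw [Finset.union_comm]; exact h'.2⟩)]

/-- The covering-pair sum is monotone in the family. -/
theorem sum_covPairsOf_mono {T T' : Finset (Finset α)} (h : T ⊆ T') (G : Finset α) :
    ∑ pp ∈ covPairsOf T G, 2 ^ (pp.1 ∩ pp.2).card ≤ ∑ pp ∈ covPairsOf T' G, 2 ^ (pp.1 ∩ pp.2).card := by
  apply Finset.sum_le_sum_of_subset
  unfold covPairsOf
  exact Finset.filter_subset_filter _ (Finset.product_subset_product h h)

/-- **Transfer from planes to traces**: for a family `S` of sets on which `P ↦ P ∩ G` is injective, the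
covering-pair sum of `S` with the weights `2^{|P ∩ P′ ∩ G|}` is the covering-pair sum of the traces.  (For
`S = planes3 M G` the left side is the sum of `Xcnt_le_sum_covPairs3`, `covPairs3 M G = covPairsOf (planes3 M G) G`
by definition, and the injectivity is `plane_eq_clF_trace`.) -/
theorem sum_covPairsOf_image_inter {S : Finset (Finset α)} {G : Finset α}
    (hinj : Set.InjOn (fun P : Finset α => P ∩ G) S) :
    ∑ pp ∈ covPairsOf S G, 2 ^ (pp.1 ∩ pp.2 ∩ G).card =
      ∑ qq ∈ covPairsOf (S.image fun P => P ∩ G) G, 2 ^ (qq.1 ∩ qq.2).card := by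
  unfold covPairsOf
  rw [Finset.sum_filter, Finset.sum_filter, Finset.sum_product, Finset.sum_product, Finset.sum_image hinj]
  apply Finset.sum_congr rfl
  intro P hP
  rw [Finset.sum_image hinj]
  apply Finset.sum_congr rfl
  intro P' hP'
  have h1 : P ∩ G ≠ P' ∩ G ↔ P ≠ P' := by
    constructor
    · intro h heq
      exact h (by rw [heq])
    · intro h heq
      exact h (hinj hP hP' heq)
  have h2 : G ⊆ P ∩ G ∪ P' ∩ G ↔ G ⊆ P ∪ P' := by
    rw [← Finset.union_inter_distrib_right, Finset.subset_inter_iff]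
    exact ⟨fun h => h.1, fun h => ⟨h, Finset.Subset.refl G⟩⟩
  have h3 : P ∩ G ∩ (P' ∩ G) = P ∩ P' ∩ G := by
    ext y
    simp only [Finset.mem_inter]
    tauto
  simp only [h1, h2, h3]

/-! ## The listed traces of a plane-line structure and the three types of covering pairs -/

/-- The `Π_j`-traces `L ∪ λ_j` (`Pi_inter_eq`: `Π_y ∩ G = λ_y ∪ (ℓ ∩ G) = L ∪ λ_y`, as `ℓ ∩ ρ ⊆ λ_y`). -/
def piTraces (L : Finset α) (C : Finset (Finset α)) : Finset (Finset α) := C.image fun A => L ∪ A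

/-- The `{x} ∪ λ` traces of the third kind of `plane_trichotomy`. -/
def xlTraces (L : Finset α) (N : Finset (Finset α)) : Finset (Finset α) :=
  (L ×ˢ N).image fun q => insert q.1 q.2

/-- The listed traces (22.12.2 (a)): `ρ`, the `L ∪ λ_j`, the `{x} ∪ λ`. -/
def tracesOf (ρ L : Finset α) (C N : Finset (Finset α)) : Finset (Finset α) :=
  insert ρ (piTraces L C ∪ xlTraces L N)

/-- The combinatorial content of a plane-line normalisation `D` with coarse profile `π`, on the traces: `ρ` and `L`
disjoint, `p = |ρ|`, `n = |L| ≥ 3`, the size list of `π` is the multiset of class sizes, classes and non-class line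
traces inside `ρ`, a class and a non-class line trace share `≤ 1` point, two distinct non-class line traces share
`≤ 1` point, two distinct classes share exactly `e` points, the cap `s_j + 2 ≤ p`, and `ν_{|λ|} > 0` for every
non-class line trace `λ` (its size is counted by `inc` and not by a class). -/
structure PLTraceData (π : PL.CProf) (ρ L : Finset α) (C N : Finset (Finset α)) : Prop where
  /-- `ρ ∩ L = ∅` -/
  disj : Disjoint ρ L
  /-- `p = |ρ|` -/
  p_eq : π.p = ρ.card
  /-- `n = |L|` -/
  n_eq : π.n = L.card
  /-- `n ≥ 3` -/
  three_le : 3 ≤ L.card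
  /-- the size list is the multiset of class sizes -/
  sizes_eq : (π.sizes : Multiset ℕ) = C.val.map Finset.card
  /-- classes lie in `ρ` -/
  class_subset : ∀ A ∈ C, A ⊆ ρ
  /-- non-class line traces lie in `ρ` -/
  line_subset : ∀ l ∈ N, l ⊆ ρ
  /-- a class and a non-class line trace share at most one point -/
  class_line : ∀ A ∈ C, ∀ l ∈ N, (A ∩ l).card ≤ 1
  /-- two distinct non-class line traces share at most one point -/
  line_line : ∀ l ∈ N, ∀ l' ∈ N, l ≠ l' → (l ∩ l').card ≤ 1
  /-- two distinct classes share exactly `e` points -/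
  class_class : ∀ A ∈ C, ∀ B ∈ C, A ≠ B → (A ∩ B).card = PL.e π
  /-- the cap: `s_j + 2 ≤ p` -/
  cap : ∀ A ∈ C, A.card + 2 ≤ ρ.card
  /-- `ν_{|λ|} > 0` for every non-class line trace -/
  nu_pos : ∀ l ∈ N, 0 < PL.nu π l.card


end PercRepro.SixFour
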